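import Literature.MathematicalPhysics.QuantumFieldTheory.VillainLaplacianGeometry
import Literature.MathematicalPhysics.QuantumFieldTheory.VillainGasEnsembles
import Literature.Probability.LatticeModels.GaussianCoordIntegration
import Literature.Probability.LatticeModels.WeightedIndependentSet
import HarnessLib

/-!
# Renormalisation of the activities of a 1-ensemble of the Villain monopole gas
# (Fröhlich–Spencer §2.8, Corollary 4 applied with independent heavy sets of cubes)

Support file for the Coulomb-gas (monopole) representation of four-dimensional `U(1)` lattice gauge
theory with the Villain action (proof programme of the named fact
`Literature.MathematicalPhysics.QuantumFieldTheory.FrohlichSpencerU1PerimeterLawD4` and of its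
corollary `Literature.Barriers.QuantumFields.AbelianDeconfinementD4`). For one term of the
closed-ensemble expansion (`VillainGasEnsembles`) — a 1-ensemble `𝒩` for the coarse adjacency
`adjC` with activities `K ≥ 0` — we choose inside the support of every `ρ ∈ 𝒩` an `adjC`-independent
set `I_ρ` carrying the fraction `1/(Δ_d+1)` of `∑_c ρ_c²` (`WeightedIndependentSet`), check that the
cubes of `⋃ I_ρ` are pairwise orthogonal for the precision `P = (4π²β)⁻¹(DDᵀ+EᵀE)` (locality of
`B'`, `VillainLaplacianGeometry`) and integrate them out by
`GaussianCoordIntegration.integral_gaussian_prod_cos_renorm` (FS82 Corollary 4): the activity of `ρ`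
acquires the factor `exp(-∑_{b∈I_ρ} ρ_b²/(2P_bb)) ≤ exp(-(2π²β/Λ_d) ∑_c ρ_c²/(Δ_d+1))`, the phases become
the renormalised linear forms `ā_ρ`, and the SAME renormalisation applies to the Wilson numerator
(shift `ψ`) and to the partition function (shift `0`):

* `degC`/`card_filter_adjC_le`, `quadForm_auxPrec`, `lin_eq_phase`, `exists_heavy_independent`;
* **`exists_renormalisation`**.

Everything is proved; no named fact is introduced.

## References

* J. Fröhlich, T. Spencer, Comm. Math. Phys. 83 (1982) 411–454, §2.8 Theorem 3, Corollary 4,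
  (2.59)–(2.66). [FrohlichSpencerCMP1982]
-/

noncomputable section

open Finset Function Matrix MeasureTheory
open scoped Real
open Literature.Probability.LatticeModels
open Literature.Probability.LatticeModels.GaussianCoord (lap)
open Literature.Probability.LatticeModels.GaussianCoord (quadForm lin renormSet measurable_lin
  integral_gaussian_prod_cos_renorm)
open Literature.Probability.LatticeModels.EnsembleExpansion (phase ensembleProd Term IsOneEnsemble IsIndependentFor partners
  mem_partners exists_independent_heavy)

namespace Literature.MathematicalPhysics.QuantumFieldTheory

namespace VillainAngle

open AxialGauge LatticeForm LatticeChain VillainFibre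

variable {d n : ℕ}

/-! ### Degree of the coarse adjacency -/

variable (d) in
/-- A bound for the number of `adjC`-neighbours of a cube: `Δ_d = 3^d d³`. [folklore] -/
def degC : ℕ := 3 ^ d * (d * (d * d))

/-- Every cube has at most `Δ_d` `adjC`-neighbours. [folklore] -/
theorem card_filter_adjC_le (c : CIdx d n) [DecidablePred fun c' : CIdx d n => adjC c c'] :
    (Finset.univ.filter fun c' : CIdx d n => adjC c c').card ≤ degC d := by
  classical
  have hcard : (Finset.univ : Finset ((Fin d → Fin 3) × (Fin d × Fin d × Fin d))).card = degC d := by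
    simp only [Finset.card_univ, Fintype.card_prod, Fintype.card_fun, Fintype.card_fin, degC]
  rw [← hcard]
  refine Finset.card_le_card_of_injOn
    (fun c' : CIdx d n => ((fun m => (⟨(c'.1.1 m - c.1.1 m + 1).toNat % 3, Nat.mod_lt _ (by norm_num)⟩ : Fin 3)), c'.1.2))
    (fun _ _ => Finset.mem_univ _) ?_
  intro a ha b hb hab
  simp only [Finset.coe_filter, Finset.mem_univ, true_and, Set.mem_setOf_eq] at ha hb
  obtain ⟨h1, h2⟩ := Prod.ext_iff.1 hab
  apply Subtype.ext
  refine Prod.ext (funext fun m => ?_) h2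
  have hm := congrFun h1 m
  simp only [Fin.mk.injEq] at hm
  have ha' := abs_le.1 (ha.2 m)
  have hb' := abs_le.1 (hb.2 m)
  omega

/-- The conflicting partners of a cube inside any set number at most `Δ_d`. [folklore] -/
theorem card_partners_adjC_le (S : Finset (CIdx d n)) (a : CIdx d n) : (partners adjC S a).card ≤ degC d := by
  classical
  refine le_trans (Finset.card_le_card fun b hb => ?_) (card_filter_adjC_le a)
  rw [mem_partners] at hb
  exact Finset.mem_filter.2 ⟨Finset.mem_univ _, hb.2.2⟩

/-! ### The Gaussian data -/

/-- The quadratic form of the function `(i, j) ↦ P_{ij}` is `⟨a, Pa⟩`. [folklore] -/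
theorem quadForm_auxPrec (β : ℝ) (a : CIdx d n → ℝ) :
    quadForm (fun i j => auxPrec (d := d) (n := n) β i j) a = a ⬝ᵥ auxPrec β *ᵥ a := by
  simp only [quadForm, dotProduct, Matrix.mulVec, Finset.mul_sum]
  exact Finset.sum_congr rfl fun i _ => Finset.sum_congr rfl fun j _ => by ring

/-- The Gaussian weight as `exp(-quadForm/2)`. [folklore] -/
theorem auxGauss_eq_exp_quadForm (β : ℝ) (a : CIdx d n → ℝ) :
    auxGauss β a = Real.exp (-(quadForm (fun i j => auxPrec (d := d) (n := n) β i j) a) / 2) := by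
  rw [auxGauss, quadForm_auxPrec]

/-- `P` is symmetric (entrywise). [folklore] -/
theorem auxPrec_symm (β : ℝ) (i j : CIdx d n) : auxPrec (d := d) (n := n) β i j = auxPrec β j i := by
  have h := (posDef_lapV (d := d) (n := n)).isHermitian
  have hij : lapV (d := d) (n := n) i j = lapV j i := by
    have := congrFun (congrFun h j) i
    simpa [Matrix.conjTranspose_apply] using this
  simp only [auxPrec, Matrix.smul_apply, smul_eq_mul, hij]

/-- The linear phase of the cast density is the ensemble phase. [folklore] -/
theorem lin_eq_phase (ρ : CIdx d n →₀ ℤ) (a : CIdx d n → ℝ) : lin (fun c => (ρ c : ℝ)) a = phase ρ a := by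
  rw [phase_eq_dotProduct, lin, dotProduct]

/-! ### Heavy independent sets inside the supports -/

/-- **FS82 (2.61)–(2.62)**: inside the support of `ρ` there is an `adjC`-independent set `I` with
`∑_{c ∈ supp ρ} ρ_c² ≤ (Δ_d + 1) ∑_{c ∈ I} ρ_c²`. [cite: FrohlichSpencerCMP1982, §2.8 (2.61)–(2.62)] -/
theorem exists_heavy_independent (ρ : CIdx d n →₀ ℤ) :
    ∃ I : Finset (CIdx d n), I ⊆ ρ.support ∧ IsIndependentFor adjC I ∧
      ∑ c ∈ ρ.support, ((ρ c : ℝ)) ^ 2 ≤ (degC d + 1) * ∑ c ∈ I, ((ρ c : ℝ)) ^ 2 := by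
  classical
  obtain ⟨I, hI, hind, hsum⟩ := exists_independent_heavy adjC adjC_symm (degC d) (fun c => ((ρ c : ℝ)) ^ 2)
    ρ.support (fun a _ => card_partners_adjC_le _ a) (fun a _ => sq_nonneg _)
  exact ⟨I, hI, hind, by exact_mod_cast hsum⟩

/-! ### The renormalisation of one term -/

/-- **Renormalisation of a 1-ensemble (FS82 Corollary 4 for the Villain monopole gas).** For
`β > 0`, a 1-ensemble `𝒩` (coarse adjacency) with activities `K ≥ 0` and any shift `ψ` there are
renormalised activities `0 ≤ z̄_ρ ≤ K_ρ exp(-(2π²β/Λ_d) ∑_c ρ_c² /(Δ_d+1))` and renormalised linear phases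
`ā_ρ` such that
`∫ e^{-½aᵀPa} ∏_ρ (1 + K_ρ cos ρ(a + ψ)) da = ∫ e^{-½aᵀPa} ∏_ρ (1 + z̄_ρ cos(ā_ρ(a) + ρ(ψ))) da` and the same
with `ψ = 0`. [cite: FrohlichSpencerCMP1982, §2.8 Corollary 4, (2.64)–(2.66)] -/
theorem exists_renormalisation {β : ℝ} (hβ : 0 < β) (N : Finset (CIdx d n →₀ ℤ)) (hens : IsOneEnsemble adjC N)
    (K : (CIdx d n →₀ ℤ) → ℝ) (hK : ∀ ρ ∈ N, 0 ≤ K ρ) (ψ : CIdx d n → ℝ) :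
    ∃ (zR : ↥N → ℝ) (aR : ↥N → CIdx d n → ℝ),
      (∀ k : ↥N, 0 ≤ zR k ∧ zR k ≤ K k * Real.exp (-(2 * π ^ 2 * β / lamV d) *
          (∑ c ∈ (k : CIdx d n →₀ ℤ).support, (((k : CIdx d n →₀ ℤ) c : ℝ)) ^ 2) / (degC d + 1))) ∧
      (∫ a, auxGauss β a * ensembleProd N K (a + ψ) =
        ∫ a, auxGauss β a * ∏ k : ↥N, (1 + zR k * Real.cos (lin (aR k) a + phase (k : CIdx d n →₀ ℤ) ψ))) ∧
      (∫ a, auxGauss β a * ensembleProd N K a =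
        ∫ a, auxGauss β a * ∏ k : ↥N, (1 + zR k * Real.cos (lin (aR k) a))) := by
  classical
  -- the heavy independent sets
  choose I hIsub hIind hIsum using fun k : ↥N => exists_heavy_independent (k : CIdx d n →₀ ℤ)
  set A : CIdx d n → CIdx d n → ℝ := fun i j => auxPrec (d := d) (n := n) β i j with hA
  set ρr : ↥N → CIdx d n → ℝ := fun k c => ((k : CIdx d n →₀ ℤ) c : ℝ) with hρr
  set zR : ↥N → ℝ := fun k => K k * Real.exp (-(∑ b ∈ I k, (ρr k b) ^ 2 / (2 * A b b))) with hzR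
  set aR : ↥N → CIdx d n → ℝ := fun k => renormSet A (I k) (ρr k) with haR
  -- hypotheses of Corollary 4
  have hApos : ∀ b : CIdx d n, 0 < A b b := fun b => by
    simp only [hA, auxPrec, Matrix.smul_apply, smul_eq_mul]
    exact mul_pos (by positivity) (lapV_diag_pos b)
  have hsep : ∀ k k' : ↥N, k ≠ k' → ∀ a ∈ (k : CIdx d n →₀ ℤ).support, ∀ b ∈ (k' : CIdx d n →₀ ℤ).support,
      a ≠ b ∧ ¬ adjC a b := fun k k' hkk' a ha b hb =>
    hens k k.2 k' k'.2 (fun h => hkk' (Subtype.ext h)) a ha b hb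
  have hdisj : ∀ k k' : ↥N, k ≠ k' → Disjoint (I k) (I k') := by
    intro k k' hkk'
    rw [Finset.disjoint_left]
    intro b hb hb'
    exact (hsep k k' hkk' b (hIsub k hb) b (hIsub k' hb')).1 rfl
  have horth : ∀ k k' : ↥N, ∀ b ∈ I k, ∀ b' ∈ I k', b ≠ b' → A b b' = 0 := by
    intro k k' b hb b' hb' hbb'
    have hnadj : ¬ adjC b b' := by
      by_cases hkk' : k = k'
      · subst hkk'; exact hIind k b hb b' hb' hbb'
      · exact (hsep k k' hkk' b (hIsub k hb) b' (hIsub k' hb')).2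
    simp only [hA, auxPrec, Matrix.smul_apply, smul_eq_mul, lapV_apply_eq_zero_of_not_adjC hbb' hnadj, mul_zero]
  have hsupp : ∀ k k' : ↥N, k ≠ k' → ∀ b ∈ I k', ρr k b = 0 := by
    intro k k' hkk' b hb
    simp only [hρr]
    have : b ∉ (k : CIdx d n →₀ ℤ).support := fun hbk => (hsep k k' hkk' b hbk b (hIsub k' hb)).1 rfl
    rw [Finsupp.notMem_support_iff.1 this, Int.cast_zero]
  have hint : Integrable fun x : CIdx d n → ℝ => Real.exp (-(quadForm A x) / 2) := by
    have : (fun x : CIdx d n → ℝ => Real.exp (-(quadForm A x) / 2)) = auxGauss β :=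
      funext fun x => (auxGauss_eq_exp_quadForm β x).symm
    rw [this]; exact integrable_auxGauss hβ
  -- Corollary 4 (complex form, spectator `G = 1`), for a general family of shifts `θ`
  have cor4 : ∀ θ : ↥N → ℝ,
      ∫ a, auxGauss β a * ∏ k : ↥N, (1 + K k * Real.cos (lin (ρr k) a - θ k)) =
        ∫ a, auxGauss β a * ∏ k : ↥N, (1 + zR k * Real.cos (lin (aR k) a - θ k)) := by
    intro θ
    have h := integral_gaussian_prod_cos_renorm A (auxPrec_symm β) hint (fun _ => (1 : ℂ)) measurable_const 1
      (fun _ => by simp) ρr (fun k => K k) θ I (fun k b _ => hApos b) hdisj horth hsupp (fun _ _ _ _ _ => rfl)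
    simp only [mul_one] at h
    apply Complex.ofReal_injective
    rw [← integral_complex_ofReal, ← integral_complex_ofReal]
    simp only [Complex.ofReal_mul, auxGauss_eq_exp_quadForm]
    exact h
  -- the product over the family as a product over the subtype, with linear phases
  have hprod : ∀ α : CIdx d n → ℝ, ensembleProd N K α = ∏ k : ↥N, (1 + K k * Real.cos (lin (ρr k) α)) := by
    intro α
    rw [ensembleProd, ← Finset.prod_coe_sort N]
    refine Finset.prod_congr rfl fun k _ => ?_
    rw [lin_eq_phase]
  have hlin : ∀ (k : ↥N) (α : CIdx d n → ℝ), lin (ρr k) α = phase (k : CIdx d n →₀ ℤ) α :=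
    fun k α => lin_eq_phase _ _
  refine ⟨zR, aR, fun k => ⟨?_, ?_⟩, ?_, ?_⟩
  · exact mul_nonneg (hK k k.2) (Real.exp_pos _).le
  · refine mul_le_mul_of_nonneg_left (Real.exp_le_exp.2 ?_) (hK k k.2)
    rw [neg_mul, neg_div, neg_le_neg_iff]
    have hΔ : (0 : ℝ) < degC d + 1 := by positivity
    calc 2 * π ^ 2 * β / lamV d * (∑ c ∈ (k : CIdx d n →₀ ℤ).support, (((k : CIdx d n →₀ ℤ) c : ℝ)) ^ 2) / (degC d + 1)
        ≤ 2 * π ^ 2 * β / lamV d * ∑ b ∈ I k, (ρr k b) ^ 2 := by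
          rw [mul_div_assoc]
          refine mul_le_mul_of_nonneg_left ?_ (div_nonneg (by positivity) lamV_nonneg)
          rw [div_le_iff₀ hΔ, mul_comm]
          exact hIsum k
      _ = ∑ b ∈ I k, (ρr k b) ^ 2 * (2 * π ^ 2 * β) / lamV d := by
          rw [Finset.mul_sum]
          exact Finset.sum_congr rfl fun b _ => by ring
      _ ≤ ∑ b ∈ I k, (ρr k b) ^ 2 / (2 * A b b) := by
          refine Finset.sum_le_sum fun b _ => ?_
          have hlb : 0 < lapV (d := d) (n := n) b b := lapV_diag_pos b
          have hAb : 2 * A b b = lapV b b / (2 * π ^ 2 * β) := by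
            simp only [hA, auxPrec, Matrix.smul_apply, smul_eq_mul]
            field_simp
            ring
          rw [hAb, div_div_eq_mul_div]
          exact div_le_div_of_nonneg_left (by positivity) hlb (lapV_diag_le b)
  · have h := cor4 fun k => -phase (k : CIdx d n →₀ ℤ) ψ
    simp only [sub_neg_eq_add] at h
    rw [← h]
    refine integral_congr_ae (Filter.Eventually.of_forall fun a => ?_)
    simp only [hprod, hlin, phase_add_right]
  · have h := cor4 fun _ => 0
    simp only [sub_zero] at h
    rw [← h]
    refine integral_congr_ae (Filter.Eventually.of_forall fun a => ?_)
    simp only [hprod]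

end VillainAngle

end Literature.MathematicalPhysics.QuantumFieldTheory
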